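import Summits.Ventures.YMGap.RobustBall.LoopWords
import HarnessLib

/-!
# RobustBall/LoopActivity — `SU(N)` estimates for word holonomies and the loop activity `τ(1 − Re tr U_w/N)`
(cell `pub-ymgap`, track Y2 ROBUST-BALL, T0.2 witnesses; p1)

HONEST FRAMING: elementary finite-torus bookkeeping for the membership certificates of concrete non-Wilson
members of the robust ball (`RobustBall/Defs`): nothing probabilistic, nothing about the continuum or a
Clay-sense mass gap.

* Frobenius telescoping `suFrobDist (hol_w σ) (hol_w τ) ≤ Σ_letters d_F(σ_e, τ_e)`, hence the one-link bound with the
  letter MULTIPLICITY `mult w y`; `|Re tr A − Re tr B| ≤ √N ‖A − B‖_F`, `|Re tr g| ≤ N`;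
* the LOOP ACTIVITY `loopActivity N τ w U = τ (1 − Re tr(hol_w U)/N)`: measurable, gauge invariant for closed walks,
  local, centre-slab invariant for balanced words, bounded by `2|τ|`, with single-link oscillation witness
  `2|τ|·mult_w(e)` (`Dobrushin.IsOscBound`) and Frobenius-Lipschitz witness `(|τ|/√N)·mult_w(e)` (`IsLipBound suFrobDist`)
  — the per-term inputs of the load computation (`RobustBall/TermPerturbation`).
-/

noncomputable section

open MeasureTheory Finset Function
open Literature.Probability.LatticeModels Literature.Probability.LatticeModels.DobrushinMetric
open Literature.MathematicalPhysics.QuantumLattice hiding torusNorm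
open Literature.MathematicalPhysics.QuantumFieldTheory hiding ZdEdge

namespace Summit.Ventures.YMGap.RobustBall

variable {d L : ℕ}

/-! ### `SU(N)`: Frobenius telescoping and trace bounds -/

section SUN

variable {N : ℕ}

/-- Inversion is an isometry of the Frobenius distance on `SU(N)`. [folklore] -/
theorem suFrobDist_inv (a b : SUN N) : suFrobDist a⁻¹ b⁻¹ = suFrobDist a b := by
  unfold suFrobDist
  rw [su_coe_inv, su_coe_inv, ← Matrix.conjTranspose_sub, frobNorm_conjTranspose]

/-- `‖a b − a' b'‖_F ≤ ‖a − a'‖_F + ‖b − b'‖_F` on `SU(N)`. [folklore] -/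
theorem suFrobDist_mul_le (a b a' b' : SUN N) :
    suFrobDist (a * b) (a' * b') ≤ suFrobDist a a' + suFrobDist b b' := by
  unfold suFrobDist
  have hsplit : ((a * b : SUN N) : Matrix (Fin N) (Fin N) ℂ) - ((a' * b' : SUN N) : Matrix (Fin N) (Fin N) ℂ) =
      ((a : Matrix (Fin N) (Fin N) ℂ) - a') * (b : Matrix (Fin N) (Fin N) ℂ) +
        (a' : Matrix (Fin N) (Fin N) ℂ) * ((b : Matrix (Fin N) (Fin N) ℂ) - b') := by
    simp only [Submonoid.coe_mul, sub_mul, mul_sub]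
    abel
  rw [hsplit]
  refine (frobNorm_add_le _ _).trans (add_le_add ?_ ?_)
  · rw [frobNorm_mul_unitary _ (su_mem_unitaryGroup b)]
  · rw [frobNorm_unitary_mul (su_mem_unitaryGroup a')]

/-- A letter is `1`-Lipschitz in its link. [folklore] -/
theorem Letter.suFrobDist_hol_le (l : Letter d L) (U V : GaugeConfig d L (SUN N)) :
    suFrobDist (l.hol U) (l.hol V) ≤ suFrobDist (U l.edge) (V l.edge) := by
  rcases l with ⟨x, k, b⟩
  cases b
  · simp [Letter.hol]
  · simp [Letter.hol, suFrobDist_inv]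

/-- **Frobenius telescoping**: `‖hol_w(U) − hol_w(V)‖_F ≤ Σ_{letters} ‖U_e − V_e‖_F`. [folklore] -/
theorem suFrobDist_wordProd_le (w : List (Letter d L)) (U V : GaugeConfig d L (SUN N)) :
    suFrobDist (wordProd w U) (wordProd w V) ≤ (w.map fun l => suFrobDist (U l.edge) (V l.edge)).sum := by
  induction w with
  | nil => simp [suFrobDist_self]
  | cons l w ih =>
    rw [wordProd_cons, wordProd_cons, List.map_cons, List.sum_cons]
    exact (suFrobDist_mul_le _ _ _ _).trans (add_le_add (l.suFrobDist_hol_le U V) ih)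

/-- One-link form: if `U = V` off `y`, then `‖hol_w(U) − hol_w(V)‖_F ≤ mult_w(y) · ‖U_y − V_y‖_F`. [folklore] -/
theorem suFrobDist_wordProd_le_mult (w : List (Letter d L)) {y : Edge d L} {U V : GaugeConfig d L (SUN N)}
    (h : ∀ z, z ≠ y → U z = V z) :
    suFrobDist (wordProd w U) (wordProd w V) ≤ mult w y * suFrobDist (U y) (V y) := by
  refine (suFrobDist_wordProd_le w U V).trans (le_of_eq ?_)
  induction w with
  | nil => simp
  | cons l w ih =>
    rw [List.map_cons, List.sum_cons, ih, mult_cons]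
    by_cases hl : l.edge = y
    · rw [hl, if_pos rfl]; push_cast; ring
    · rw [if_neg hl, h _ hl, suFrobDist_self]; push_cast; ring

/-- `|Re tr A − Re tr B| ≤ √N ‖A − B‖_F` on `SU(N)`. [folklore] -/
theorem abs_re_trace_sub_le_suFrobDist (a b : SUN N) :
    |(a : Matrix (Fin N) (Fin N) ℂ).trace.re - (b : Matrix (Fin N) (Fin N) ℂ).trace.re| ≤
      Real.sqrt N * suFrobDist a b := by
  have h := abs_re_trace_mul_le (1 : Matrix (Fin N) (Fin N) ℂ)
    ((a : Matrix (Fin N) (Fin N) ℂ) - (b : Matrix (Fin N) (Fin N) ℂ))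
  rw [one_mul, Matrix.trace_sub, Complex.sub_re] at h
  have h1 : frobNorm (1 : Matrix (Fin N) (Fin N) ℂ) = Real.sqrt N := by
    simpa using frobNorm_su (1 : SUN N)
  rwa [h1] at h

/-- `|Re tr g| ≤ N` on `SU(N)`. [folklore] -/
theorem abs_re_trace_su_le (g : SUN N) : |(g : Matrix (Fin N) (Fin N) ℂ).trace.re| ≤ N := by
  have h := abs_re_trace_su_mul_le g (1 : Matrix (Fin N) (Fin N) ℂ)
  rw [mul_one] at h
  have h1 : frobNorm (1 : Matrix (Fin N) (Fin N) ℂ) = Real.sqrt N := by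
    simpa using frobNorm_su (1 : SUN N)
  rw [h1, Real.mul_self_sqrt (Nat.cast_nonneg N)] at h
  exact h

/-- The real trace of a closed-walk holonomy is gauge invariant. [folklore] -/
theorem re_trace_wordProd_gaugeTransform {w : List (Letter d L)} {s : Site d L} (hw : IsWalk s w s)
    (g : Site d L → SUN N) (U : GaugeConfig d L (SUN N)) :
    ((wordProd w (gaugeTransform g U) : SUN N) : Matrix (Fin N) (Fin N) ℂ).trace.re =
      ((wordProd w U : SUN N) : Matrix (Fin N) (Fin N) ℂ).trace.re := by
  rw [wordProd_gaugeTransform hw, Submonoid.coe_mul, Submonoid.coe_mul, Matrix.trace_mul_cycle, ← Submonoid.coe_mul,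
    inv_mul_cancel, OneMemClass.coe_one, one_mul]

/-- Word holonomies are continuous in the configuration. [folklore] -/
theorem continuous_wordProd (w : List (Letter d L)) :
    Continuous fun U : GaugeConfig d L (SUN N) => wordProd w U := by
  induction w with
  | nil => exact continuous_const
  | cons l w ih =>
    simp only [wordProd_cons]
    refine Continuous.mul ?_ ih
    rcases l with ⟨x, k, b⟩
    cases b
    · have : (Letter.mk x k false).hol = fun U : GaugeConfig d L (SUN N) => U (x, k) := by
        funext U; simp [Letter.hol]
      rw [this]; exact continuous_apply _
    · have : (Letter.mk x k true).hol = fun U : GaugeConfig d L (SUN N) => (U (x, k))⁻¹ := by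
        funext U; simp [Letter.hol]
      rw [this]; exact (continuous_apply _).inv

/-- Word holonomies are measurable in the configuration (product σ-algebra). [folklore] -/
theorem measurable_wordProd (w : List (Letter d L)) :
    Measurable fun U : GaugeConfig d L (SUN N) => wordProd w U := by
  haveI : SecondCountableTopology (Matrix (Fin N) (Fin N) ℂ) :=
    inferInstanceAs (SecondCountableTopology (Fin N → Fin N → ℂ))
  haveI : SecondCountableTopology (SUN N) := Topology.IsEmbedding.subtypeVal.secondCountableTopology
  induction w with
  | nil => exact measurable_const
  | cons l w ih =>
    simp only [wordProd_cons]
    refine Measurable.mul ?_ ih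
    rcases l with ⟨x, k, b⟩
    cases b
    · have : (Letter.mk x k false).hol = fun U : GaugeConfig d L (SUN N) => U (x, k) := by
        funext U; simp [Letter.hol]
      rw [this]; exact measurable_pi_apply _
    · have : (Letter.mk x k true).hol = fun U : GaugeConfig d L (SUN N) => (U (x, k))⁻¹ := by
        funext U; simp [Letter.hol]
      rw [this]; exact (measurable_pi_apply _).inv

/-- `g ↦ Re tr g` is continuous on `SU(N)`. [folklore] -/
theorem continuous_re_trace_su : Continuous fun g : SUN N => (g : Matrix (Fin N) (Fin N) ℂ).trace.re :=
  Complex.continuous_re.comp (continuous_subtype_val.matrix_trace)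

/-- The real trace of a word holonomy is continuous. [folklore] -/
theorem continuous_re_trace_wordProd (w : List (Letter d L)) :
    Continuous fun U : GaugeConfig d L (SUN N) =>
      ((wordProd w U : SUN N) : Matrix (Fin N) (Fin N) ℂ).trace.re :=
  continuous_re_trace_su.comp (continuous_wordProd w)

/-! ### The loop activity -/

/-- The LOOP ACTIVITY of the word `w` with coefficient `τ`: `τ · (1 − Re tr(hol_w U)/N)`. [folklore] -/
def loopActivity (N : ℕ) (τ : ℝ) (w : List (Letter d L)) (U : GaugeConfig d L (SUN N)) : ℝ :=
  τ * (1 - ((wordProd w U : SUN N) : Matrix (Fin N) (Fin N) ℂ).trace.re / N)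

/-- `|Re tr g / N| ≤ 1` (also for `N = 0`, where it is `0`). [folklore] -/
theorem abs_re_trace_div_le_one (g : SUN N) : |(g : Matrix (Fin N) (Fin N) ℂ).trace.re / N| ≤ 1 := by
  rcases Nat.eq_zero_or_pos N with hN | hN
  · subst hN; simp
  · rw [abs_div, Nat.abs_cast, div_le_one (by exact_mod_cast hN)]
    exact abs_re_trace_su_le g

/-- `|loopActivity| ≤ 2|τ|`. [folklore] -/
theorem abs_loopActivity_le (τ : ℝ) (w : List (Letter d L)) (U : GaugeConfig d L (SUN N)) :
    |loopActivity N τ w U| ≤ 2 * |τ| := by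
  unfold loopActivity
  rw [abs_mul, mul_comm 2]
  refine mul_le_mul_of_nonneg_left ?_ (abs_nonneg τ)
  have h := abs_re_trace_div_le_one (wordProd w U : SUN N)
  rw [abs_le] at h ⊢
  constructor <;> linarith [h.1, h.2]

/-- Oscillation of the loop activity between ANY two configurations is `≤ 2|τ|`. [folklore] -/
theorem abs_loopActivity_sub_le (τ : ℝ) (w : List (Letter d L)) (U V : GaugeConfig d L (SUN N)) :
    |loopActivity N τ w U - loopActivity N τ w V| ≤ 2 * |τ| := by
  unfold loopActivity
  rw [← mul_sub, abs_mul, mul_comm 2]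
  refine mul_le_mul_of_nonneg_left ?_ (abs_nonneg τ)
  have h1 := abs_re_trace_div_le_one (wordProd w U : SUN N)
  have h2 := abs_re_trace_div_le_one (wordProd w V : SUN N)
  rw [abs_le] at h1 h2 ⊢
  constructor <;> linarith [h1.1, h1.2, h2.1, h2.2]

/-- **One-link Frobenius-Lipschitz bound of the loop activity**: if `U = V` off `y`,
`|A(U) − A(V)| ≤ (|τ|/√N) · mult_w(y) · ‖U_y − V_y‖_F`. [folklore] -/
theorem abs_loopActivity_sub_le_mult (τ : ℝ) (w : List (Letter d L)) {y : Edge d L}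
    {U V : GaugeConfig d L (SUN N)} (h : ∀ z, z ≠ y → U z = V z) :
    |loopActivity N τ w U - loopActivity N τ w V| ≤ |τ| / Real.sqrt N * mult w y * suFrobDist (U y) (V y) := by
  unfold loopActivity
  rw [← mul_sub, abs_mul, sub_sub_sub_cancel_left, ← sub_div, abs_div, Nat.abs_cast]
  rcases Nat.eq_zero_or_pos N with hN | hN
  · subst hN; simp
  have hs : 0 < Real.sqrt N := Real.sqrt_pos.2 (by exact_mod_cast hN)
  have key := (abs_re_trace_sub_le_suFrobDist (wordProd w V : SUN N) (wordProd w U)).trans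
    (mul_le_mul_of_nonneg_left ((suFrobDist_wordProd_le_mult w (fun z hz => (h z hz).symm)))
      (Real.sqrt_nonneg _))
  rw [suFrobDist_comm] at key
  have hNs : (N : ℝ) = Real.sqrt N * Real.sqrt N := (Real.mul_self_sqrt (Nat.cast_nonneg N)).symm
  calc |τ| * (|((wordProd w V : SUN N) : Matrix (Fin N) (Fin N) ℂ).trace.re -
          ((wordProd w U : SUN N) : Matrix (Fin N) (Fin N) ℂ).trace.re| / N)
      ≤ |τ| * (Real.sqrt N * (mult w y * suFrobDist (U y) (V y)) / N) := by
        gcongr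
    _ = |τ| * (Real.sqrt N * (mult w y * suFrobDist (U y) (V y)) / (Real.sqrt N * Real.sqrt N)) := by
        rw [← hNs]
    _ = |τ| / Real.sqrt N * mult w y * suFrobDist (U y) (V y) := by
        rw [mul_div_mul_left _ _ hs.ne']; ring

/-- The loop activity is continuous. [folklore] -/
theorem continuous_loopActivity (τ : ℝ) (w : List (Letter d L)) :
    Continuous (loopActivity (d := d) (L := L) N τ w) := by
  unfold loopActivity
  exact continuous_const.mul (continuous_const.sub ((continuous_re_trace_wordProd w).div_const _))

/-- The loop activity is measurable. [folklore] -/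
theorem measurable_loopActivity (τ : ℝ) (w : List (Letter d L)) :
    Measurable (loopActivity (d := d) (L := L) N τ w) := by
  unfold loopActivity
  exact measurable_const.mul
    (measurable_const.sub ((continuous_re_trace_su.measurable.comp (measurable_wordProd w)).div_const _))

/-- The loop activity of a closed walk is gauge invariant. [folklore] -/
theorem isGaugeInvariant_loopActivity {w : List (Letter d L)} {s : Site d L} (hw : IsWalk s w s) (τ : ℝ) :
    IsGaugeInvariant (loopActivity (d := d) (L := L) N τ w) :=
  fun g U => by simp only [loopActivity, re_trace_wordProd_gaugeTransform hw]

/-- The loop activity reads only the links of its letters. [folklore] -/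
theorem dependsOn_loopActivity (τ : ℝ) (w : List (Letter d L)) :
    DependsOn (loopActivity (d := d) (L := L) N τ w) (↑(wordEdges w) : Set (Edge d L)) :=
  fun _ _ h => by simp only [loopActivity, dependsOn_wordProd w h]

/-- The loop activity of a balanced word is centre-slab invariant. [folklore] -/
theorem loopActivity_centerSlabRotate {w : List (Letter d L)} (hw : ∀ v t, netCount w v t = 0) (τ : ℝ)
    (v : Fin d) (t : ZMod L) {z : SUN N} (hz : z ∈ Subgroup.center (SUN N)) (U : GaugeConfig d L (SUN N)) :
    loopActivity N τ w (centerSlabRotate v t z U) = loopActivity N τ w U := by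
  simp only [loopActivity, wordProd_centerSlabRotate_of_balanced hw v t hz]

/-- The single-link OSCILLATION witness of the loop activity: `2|τ| · mult_w(e)`. [folklore] -/
theorem isOscBound_loopActivity (τ : ℝ) (w : List (Letter d L)) :
    Dobrushin.IsOscBound (loopActivity (d := d) (L := L) N τ w) fun e => 2 * |τ| * mult w e := by
  refine ⟨fun e => by positivity, fun y U V h => ?_⟩
  rcases Nat.eq_zero_or_pos (mult w y) with hm | hm
  · have : loopActivity N τ w U = loopActivity N τ w V :=
      dependsOn_loopActivity τ w fun e he => h e fun hey => by
        rw [hey] at he; exact (mult_eq_zero_iff.1 hm) he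
    rw [this, sub_self, abs_zero]; positivity
  · refine (abs_loopActivity_sub_le τ w U V).trans ?_
    have : (1 : ℝ) ≤ mult w y := by exact_mod_cast hm
    nlinarith [abs_nonneg τ]

/-- The single-link Frobenius-LIPSCHITZ witness of the loop activity: `(|τ|/√N) · mult_w(e)`. [folklore] -/
theorem isLipBound_loopActivity (τ : ℝ) (w : List (Letter d L)) :
    IsLipBound suFrobDist (loopActivity (d := d) (L := L) N τ w) fun e => |τ| / Real.sqrt N * mult w e :=
  ⟨fun e => by positivity, fun y U V h => abs_loopActivity_sub_le_mult τ w h⟩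

end SUN

end Summit.Ventures.YMGap.RobustBall

end
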